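import Literature.Probability.Percolation.QuadCrossingSquareModel
import HarnessLib

/-!
# Monotonicity of the crossing event between model boxes read in two `ν`-close charts
# (crux `SubseqCardy`, stmt-CriticalPhenomena-5768, line `registered`, lead c4: W3 self-duality, part D)

Route `CardyAnchoredRigidity` (decl shared with `CardyLocalRigidity`), sub-problem `CardyFormulaZ2`.
W3 is the general SELF-DUALITY `g R + g R⁺ = 1` of the joint sequential limits `g` of the bond-`ℤ²`
crossing probabilities (`R⁺` = the same Jordan domain with the marks advanced by one, so that its
crossings join the two other arcs). Its combinatorial heart compares a primal crossing of a quad with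
a dual crossing of the conjugate quad, and the dual lattice `δℤ² + δ(½, ½)` is a TRANSLATE of `δℤ²`:
read through the translated chart `Ψ' = Ψ ∓ δ(½, ½)` a fixed model box becomes a slightly moved one.
To replace moving quads by fixed ones one needs the monotonicity of the Schramm–Smirnov crossing
event between model boxes read in two nearby charts, which is what this file proves.

* `quadCrossing_perturbQuad_mono_of_near` — generalises the tree's
  `Literature.Probability.Percolation.quadCrossing_perturbQuad_mono` (ONE chart `Φ`: if
  `[x₀', x₁'] ⊆ [x₀, x₁]` and `[y₀, y₁] ⊆ [y₀', y₁']` then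
  `𝒞_δ(Φ([x₀', x₁'] × [y₀', y₁'])) ⊆ 𝒞_δ(Φ([x₀, x₁] × [y₀, y₁]))`) to TWO charts `Ψ, Ψ' : ℂ ≃ₜ ℂ` whose
  inverse charts differ coordinatewise by at most `ν` on the closed narrower-taller quad
  `Ψ([x₀', x₁'] × [y₀', y₁'])`: if the second box is wider and shorter by the margin `ν`
  (`x₀ ≤ x₀' - ν`, `x₁' + ν ≤ x₁`, `y₀' + ν ≤ y₀`, `y₁ ≤ y₁' - ν`), then every open crossing of
  `Ψ([x₀', x₁'] × [y₀', y₁'])` from its bottom to its top side contains an open crossing of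
  `Ψ'([x₀, x₁] × [y₀, y₁])` — the piece between the last passage of its `Ψ'`-model height at `y₀`
  and the first subsequent passage at `y₁` (`exists_Icc_passage`) — so
  `𝒞_δ(Ψ([x₀', x₁'] × [y₀', y₁'])) ⊆ 𝒞_δ(Ψ'([x₀, x₁] × [y₀, y₁]))` at every mesh `δ`.

The proof is the tree's proof of `quadCrossing_perturbQuad_mono` with the path read in the other
chart. Nothing else is here (the application to the dual shift is the lead's file).

References: O. Schramm, S. Smirnov, *On the scaling limits of planar percolation*, Ann. Probab. 39
(2011) 1768–1814, §1.3 (quads, crossings, the partial order "every crossing of `Q₂` contains a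
crossing of `Q₁`"), §5 proof of Lemma 5.1 (the perturbations `Q^q`).
-/

noncomputable section

namespace Summit.CriticalPhenomena.CardyFormulaZ2.Cruxes.SubseqCardy.Birth

open Set
open Literature.Probability.Percolation (perturbQuad quadCrossing openEdgeUnion exists_Icc_passage
  mem_closure_perturbQuad_carrier mem_perturbQuad_arc_zero mem_perturbQuad_arc_two)

/-- **Monotonicity of the crossing event between model boxes read in two `ν`-close charts**
(Schramm–Smirnov's order `Q ≤ Q'`: "every crossing of `Q'` contains a crossing of `Q`", Ann. Probab.
39 (2011), §1.3, for model perturbations in two charts). Let `Ψ, Ψ' : ℂ ≃ₜ ℂ` be two charts whose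
inverses differ coordinatewise by at most `ν` on the closed quad `Ψ([x₀', x₁'] × [y₀', y₁'])`, and let
the box `[x₀, x₁] × [y₀, y₁]` be wider and shorter than `[x₀', x₁'] × [y₀', y₁']` by the margin `ν`.
Then every open crossing of `Ψ([x₀', x₁'] × [y₀', y₁'])` from its bottom to its top side contains an
open crossing of `Ψ'([x₀, x₁] × [y₀, y₁])` (the piece between the last passage of its `Ψ'`-model
height at `y₀` and the first subsequent passage at `y₁`), so the crossing event of the former is
contained in that of the latter, at every mesh. For `Ψ' = Ψ` and `ν = 0` this is
`Literature.Probability.Percolation.quadCrossing_perturbQuad_mono`.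
[cite: SchrammSmirnov2011, §1.3 (the partial order on quads)] -/
theorem quadCrossing_perturbQuad_mono_of_near : ∀ (Ψ Ψ' : ℂ ≃ₜ ℂ) (ν : ℝ)
    (x₀ x₁ y₀ y₁ x₀' x₁' y₀' y₁' : ℝ) (hx : x₀ < x₁) (hy : y₀ < y₁) (hx' : x₀' < x₁')
    (hy' : y₀' < y₁'), x₀ ≤ x₀' - ν → x₁' + ν ≤ x₁ → y₀' + ν ≤ y₀ → y₁ ≤ y₁' - ν →
    (∀ z ∈ closure (Literature.Probability.Percolation.perturbQuad Ψ x₀' x₁' y₀' y₁' hx' hy').carrier,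
      |(Ψ'.symm z).re - (Ψ.symm z).re| ≤ ν ∧ |(Ψ'.symm z).im - (Ψ.symm z).im| ≤ ν) →
    ∀ δ : ℝ, Literature.Probability.Percolation.quadCrossing
      (Literature.Probability.Percolation.perturbQuad Ψ x₀' x₁' y₀' y₁' hx' hy') δ ⊆
      Literature.Probability.Percolation.quadCrossing
        (Literature.Probability.Percolation.perturbQuad Ψ' x₀ x₁ y₀ y₁ hx hy) δ := by
  intro Ψ Ψ' ν x₀ x₁ y₀ y₁ x₀' x₁' y₀' y₁' hx hy hx' hy' h₀ h₁ h₂ h₃ hnear δ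
  rintro ω ⟨a, ha, b, hb, γ, hγ⟩
  rw [mem_perturbQuad_arc_zero] at ha
  rw [mem_perturbQuad_arc_two] at hb
  -- the endpoints lie in the closed narrower-taller quad, where the two charts are `ν`-close
  have haC : a ∈ closure (perturbQuad Ψ x₀' x₁' y₀' y₁' hx' hy').carrier :=
    (mem_closure_perturbQuad_carrier hx' hy' Ψ).2 ⟨ha.2, by rw [ha.1]; exact left_mem_Icc.2 hy'.le⟩
  have hbC : b ∈ closure (perturbQuad Ψ x₀' x₁' y₀' y₁' hx' hy').carrier :=
    (mem_closure_perturbQuad_carrier hx' hy' Ψ).2 ⟨hb.2, by rw [hb.1]; exact right_mem_Icc.2 hy'.le⟩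
  -- the `Ψ'`-model height along the path
  set g : ℝ → ℂ := fun t => Ψ'.symm (γ.extend t) with hg
  have hgc : Continuous g := Ψ'.symm.continuous.comp γ.continuous_extend
  set f : ℝ → ℝ := fun t => (g t).im with hf
  have hfc : Continuous f := Complex.continuous_im.comp hgc
  have hf0 : f 0 ≤ y₀ := by
    have h := (abs_le.1 (hnear a haC).2).2
    simp only [hf, hg, γ.extend_zero]
    linarith [ha.1]
  have hf1 : y₁ ≤ f 1 := by
    have h := (abs_le.1 (hnear b hbC).2).1
    simp only [hf, hg, γ.extend_one]
    linarith [hb.1]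
  obtain ⟨t₀, t₁, h0t₀, ht₀t₁, ht₁1, hft₀, hft₁, hrange⟩ :=
    exists_Icc_passage zero_le_one hfc.continuousOn hf0 hf1 hy
  -- points of the path in `[t₀, t₁]` lie in the wider-shorter closed `Ψ'`-quad and on open edges
  have hmemF : ∀ t ∈ Icc t₀ t₁, γ.extend t ∈
      closure (perturbQuad Ψ' x₀ x₁ y₀ y₁ hx hy).carrier ∩ openEdgeUnion δ ω := by
    intro t ht
    have ht01 : t ∈ Icc (0 : ℝ) 1 := ⟨h0t₀.trans ht.1, ht.2.trans ht₁1⟩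
    have hγt : γ.extend t ∈ closure (perturbQuad Ψ x₀' x₁' y₀' y₁' hx' hy').carrier ∩
        openEdgeUnion δ ω := by
      rw [γ.extend_apply ht01]; exact hγ _
    have h1 := (mem_closure_perturbQuad_carrier hx' hy' Ψ).1 hγt.1
    have h2 := abs_le.1 (hnear _ hγt.1).1
    exact ⟨(mem_closure_perturbQuad_carrier hx hy Ψ').2
      ⟨⟨by linarith [h1.1.1, h2.1], by linarith [h1.1.2, h2.2]⟩, hrange t ht⟩, hγt.2⟩
  have hre : ∀ t ∈ Icc t₀ t₁, (Ψ'.symm (γ.extend t)).re ∈ Icc x₀ x₁ := fun t ht =>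
    ((mem_closure_perturbQuad_carrier hx hy Ψ').1 (hmemF t ht).1).1
  refine ⟨γ.extend t₀, ?_, γ.extend t₁, ?_, ?_⟩
  · rw [mem_perturbQuad_arc_zero]
    exact ⟨hft₀, hre t₀ (left_mem_Icc.2 ht₀t₁)⟩
  · rw [mem_perturbQuad_arc_two]
    exact ⟨hft₁, hre t₁ (right_mem_Icc.2 ht₀t₁)⟩
  · have hpc : IsPathConnected (γ.extend '' Icc t₀ t₁) :=
      ((convex_Icc t₀ t₁).isPathConnected ⟨t₀, left_mem_Icc.2 ht₀t₁⟩).image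
        γ.continuous_extend
    exact (hpc.joinedIn _ (mem_image_of_mem _ (left_mem_Icc.2 ht₀t₁)) _
      (mem_image_of_mem _ (right_mem_Icc.2 ht₀t₁))).mono (by
        rintro _ ⟨t, ht, rfl⟩; exact hmemF t ht)

end Summit.CriticalPhenomena.CardyFormulaZ2.Cruxes.SubseqCardy.Birth
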